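import Mathlib
import Literature.Analysis.SpecialFunctions.DilogarithmRealArgument
import Literature.Analysis.SpecialFunctions.PowerLogMoments
import Literature.NumberTheory.Transcendental.PeriodsWave0
import HarnessLib

/-!
# The Euler kernel `E(u) = Li₂(u) + log u · log(1 − u)`: its power series and the nine `E`-linear basis integrals
# (cell `pub-zeta5`, seat ct-1 g21; item (3) of the wedge-dictionary programme, first deliverable, part 1)

HONEST FRAMING: systematic search; no irrationality claim unless certified.  Elementary real analysis only:
one-variable integrals over `(0,1)` of the function

  `E(u) := Li₂(u) + log u · log(1 − u)`   (`Li₂ = reDilog`, the tree's real dilogarithm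
  [`Literature.Analysis.SpecialFunctions.DilogarithmRealArgument`]; on `(0,1)`, `E(u) = ζ(2) − Li₂(1 − u)` by Euler's
  reflection `reDilog_reflection`),

which is the kernel of the last (fifth) integration in gen-1 g17's human evaluation of the level-1 datum
`D2 = I(1,0,1,0,1,1,0,1)` of Brown–Zudilin's cellular integrals (`LEVEL1-EXACT.md` Theorem E; memo
`ct-1/g20/TOPPAIR-D17.md` §6).  Everything is written out (no notation, no definition), so that the statements can be
quoted verbatim downstream.  Contents:

1. `hasSum_Ek_div` — the power series `E(u)/u = Σ_{n ≥ 0} uⁿ (1/(n+1)² + ℓ/(n+1))`, `ℓ = −log u`, on `(0,1)`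
   (from `Li₂(u) = Σ uⁿ/n²`, `reDilog_eq_realDilog`, and Mathlib's `−log(1−u) = Σ uⁿ/n`); all terms are `≥ 0`, so
   `E ≥ 0` on `(0,1)`; `hasSum_inv_succ_pow` & co.: `Σ (n+1)^{−k} = ζ(k)`, `Σ (n+2)^{−k} = ζ(k) − 1`,
   `Σ (n+3)^{−k} = ζ(k) − 1 − 2^{−k}` for the tree's `zetaValue k = Σ' n, 1/n^k`.
2. `lintegral_const_mul_pow_mul_negLog_pow` — the moments `∫₀¹ uⁿ ℓᵖ du = p!/(n+1)^{p+1}` in `ℝ≥0∞`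
   (the tree's `integral_rpow_mul_log_pow_zero_one`, Gradshteyn–Ryzhik 4.272 6).
3. THE ENGINE `lintegral_basis` / `integral_basis`: for all `j, p ∈ ℕ`,
   `∫₀¹ uʲ ℓᵖ E(u) du/u = Σ_{n ≥ 0} [p!/((n+1)²(n+j+1)^{p+1}) + (p+1)!/((n+1)(n+j+1)^{p+2})]`
   — termwise integration of a series of NON-NEGATIVE functions (Tonelli for series, `lintegral_tsum`), then back to
   the Bochner integral with integrability (`integral_eq_lintegral_of_nonneg_ae`).
4. The nine `E`-linear basis integrals of Theorem E, each with `IntegrableOn … (Ioo 0 1)`: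
   `B1 = ∫E = 1`, `B2 = ∫uE = 5/8`, `B3 = ∫E/u = 2ζ(3)`, `B4 = ∫ℓE = 3 − 2ζ(3)`, `B4' = ∫uℓE = 23/16 − ζ(3)`,
   `B5 = ∫ℓE/u = 3ζ(4)`, `B9 = ∫ℓ²E = 12 − 4ζ(3) − 6ζ(4)`, `B10 = ∫ℓ²E/u = 8ζ(5)`, `B11 = ∫uℓ²E = 37/8 − ζ(3) − 3ζ(4)`
   (`ζ(k) = zetaValue k`).  The series are evaluated by the partial fractions recorded in each docstring — e.g.
   `1/(n²(n+1)²) + 2/(n(n+1)³) = 1/n² − 1/(n+1)² − 2/(n+1)³` — which involve NO `1/n` terms, so only the shifted zeta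
   series of item 1 are needed (no telescoping of divergent pieces).

NOT here (later files of the same deliverable): the three quadratic integrals `B6 = ∫E² = 6 − 4ζ(3)`,
`B8 = ∫uE² = 71/16 − 3ζ(3)` (integration by parts, `E' = ℓ/(1−u)`) and the one depth-two input `B7 = ∫E²/u = 2ζ(5)`
(Tornheim double series → `ζ(4,1)`, `ζ(3,2)` via the tree's `MultipleZetaShuffleProofs` / `MultipleZetaWeightFiveProofs`).
Nothing here mentions the cellular integrals; nothing about `ζ(5)`'s irrationality; no named fact is introduced or used.
-/

noncomputable section

open MeasureTheory Set Filter Topology intervalIntegral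
open scoped ENNReal Nat

namespace Summit.KontsevichZagierPeriods.Zeta5Search.EulerKernel

open Literature.Analysis.SpecialFunctions (reDilog realDilog reDilog_eq_realDilog continuous_reDilog)
open Literature.NumberTheory.Transcendental (zetaValue)

/-! ## 1. The power series `E(u)/u = Σ_{n ≥ 0} uⁿ (1/(n+1)² + ℓ/(n+1))`, `ℓ = −log u`, on `(0,1)` -/

/-- `Σ_{n ≥ 0} (n+1)^{−k} = ζ(k)` (`HasSum` form) for `k ≥ 2`. [folklore] -/
theorem hasSum_inv_succ_pow {k : ℕ} (hk : 2 ≤ k) :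
    HasSum (fun n : ℕ => 1 / ((n : ℝ) + 1) ^ k) (zetaValue k) := by
  have hs : Summable (fun n : ℕ => 1 / (n : ℝ) ^ k) := Real.summable_one_div_nat_pow.mpr hk
  have h := (hasSum_nat_add_iff' (f := fun n : ℕ => 1 / (n : ℝ) ^ k) 1).mpr hs.hasSum
  simp only [Finset.range_one, Finset.sum_singleton, Nat.cast_zero,
    zero_pow (by omega : k ≠ 0), div_zero, sub_zero, Nat.cast_add, Nat.cast_one] at h
  exact h

/-- `Σ_{n ≥ 0} (n+2)^{−k} = ζ(k) − 1` for `k ≥ 2`. [folklore] -/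
theorem hasSum_inv_add_two_pow {k : ℕ} (hk : 2 ≤ k) :
    HasSum (fun n : ℕ => 1 / ((n : ℝ) + 2) ^ k) (zetaValue k - 1) := by
  have h := (hasSum_nat_add_iff' (f := fun n : ℕ => 1 / ((n : ℝ) + 1) ^ k) 1).mpr (hasSum_inv_succ_pow hk)
  simp only [Finset.range_one, Finset.sum_singleton, Nat.cast_zero, zero_add, one_pow, div_one,
    Nat.cast_add, Nat.cast_one] at h
  rw [show (fun n : ℕ => 1 / ((n : ℝ) + 2) ^ k) = fun n : ℕ => 1 / ((n : ℝ) + 1 + 1) ^ k from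
    funext fun n => by rw [add_assoc, one_add_one_eq_two]]
  exact h

/-- `Σ_{n ≥ 0} (n+3)^{−k} = ζ(k) − 1 − 2^{−k}` for `k ≥ 2`. [folklore] -/
theorem hasSum_inv_add_three_pow {k : ℕ} (hk : 2 ≤ k) :
    HasSum (fun n : ℕ => 1 / ((n : ℝ) + 3) ^ k) (zetaValue k - 1 - 1 / 2 ^ k) := by
  have h := (hasSum_nat_add_iff' (f := fun n : ℕ => 1 / ((n : ℝ) + 2) ^ k) 1).mpr (hasSum_inv_add_two_pow hk)
  simp only [Finset.range_one, Finset.sum_singleton, Nat.cast_zero, zero_add, Nat.cast_add, Nat.cast_one] at h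
  rw [show (fun n : ℕ => 1 / ((n : ℝ) + 3) ^ k) = fun n : ℕ => 1 / ((n : ℝ) + 1 + 2) ^ k from
    funext fun n => by rw [add_assoc]; norm_num]
  exact h

/-- The dilogarithm series `Li₂(t) = Σ t^{n+1}/(n+1)²` converges (as a `HasSum`) for `0 ≤ t ≤ 1`. [folklore] -/
theorem hasSum_realDilog {t : ℝ} (h0 : 0 ≤ t) (h1 : t ≤ 1) :
    HasSum (fun n : ℕ => t ^ (n + 1) / ((n : ℝ) + 1) ^ 2) (realDilog t) := by
  have hs : Summable (fun n : ℕ => t ^ (n + 1) / ((n : ℝ) + 1) ^ 2) := by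
    refine Summable.of_nonneg_of_le (fun n => by positivity) (fun n => ?_) (hasSum_inv_succ_pow le_rfl).summable
    have hp : t ^ (n + 1) ≤ 1 := pow_le_one₀ h0 h1
    exact div_le_div_of_nonneg_right hp (by positivity)
  simpa [realDilog] using hs.hasSum

/-- **The series of the Euler kernel**: for `0 < u < 1`,
`E(u)/u = Σ_{n ≥ 0} uⁿ (1/(n+1)² + (−log u)/(n+1))` — from `Li₂(u) = Σ uⁿ/n²` and `−log(1−u) = Σ uⁿ/n`.
All terms are non-negative. [folklore] -/
theorem hasSum_Ek_div {u : ℝ} (h0 : 0 < u) (h1 : u < 1) :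
    HasSum (fun n : ℕ => u ^ n * (1 / ((n : ℝ) + 1) ^ 2 + (-Real.log u) / ((n : ℝ) + 1))) ((reDilog u + Real.log u * Real.log (1 - u)) / u) := by
  have hA : HasSum (fun n : ℕ => u ^ (n + 1) / ((n : ℝ) + 1) ^ 2) (reDilog u) := by
    rw [reDilog_eq_realDilog (abs_le.2 ⟨by linarith, h1.le⟩)]
    exact hasSum_realDilog h0.le h1.le
  have hB : HasSum (fun n : ℕ => u ^ (n + 1) / ((n : ℝ) + 1)) (-Real.log (1 - u)) :=
    Real.hasSum_pow_div_log_of_abs_lt_one (abs_lt.2 ⟨by linarith, h1⟩)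
  have hC : HasSum (fun n : ℕ => (-Real.log u) * (u ^ (n + 1) / ((n : ℝ) + 1)))
      ((-Real.log u) * (-Real.log (1 - u))) := hB.mul_left (-Real.log u)
  have hD : HasSum (fun n : ℕ => u⁻¹ * (u ^ (n + 1) / ((n : ℝ) + 1) ^ 2 + (-Real.log u) * (u ^ (n + 1) / ((n : ℝ) + 1))))
      (u⁻¹ * (reDilog u + (-Real.log u) * (-Real.log (1 - u)))) := (hA.add hC).mul_left u⁻¹
  have hu : u ≠ 0 := h0.ne'
  have hfun : (fun n : ℕ => u ^ n * (1 / ((n : ℝ) + 1) ^ 2 + (-Real.log u) / ((n : ℝ) + 1))) =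
      (fun n : ℕ => u⁻¹ * (u ^ (n + 1) / ((n : ℝ) + 1) ^ 2 + (-Real.log u) * (u ^ (n + 1) / ((n : ℝ) + 1)))) := by
    funext n
    rw [pow_succ]
    field_simp
    ring
  have hval : (reDilog u + Real.log u * Real.log (1 - u)) / u = u⁻¹ * (reDilog u + (-Real.log u) * (-Real.log (1 - u))) := by
    rw [neg_mul_neg, div_eq_inv_mul]
  rw [hfun, hval]
  exact hD

/-- Every term of the series of `E(u)/u` is non-negative on `(0,1)`. [folklore] -/
theorem Ek_term_nonneg {u : ℝ} (h0 : 0 < u) (h1 : u < 1) (n : ℕ) :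
    0 ≤ u ^ n * (1 / ((n : ℝ) + 1) ^ 2 + (-Real.log u) / ((n : ℝ) + 1)) := by
  have hl : 0 ≤ -Real.log u := by
    rw [neg_nonneg]; exact Real.log_nonpos h0.le h1.le
  positivity

/-- `E(u)/u ≥ 0` on `(0,1)`. [folklore] -/
theorem Ek_div_nonneg {u : ℝ} (h0 : 0 < u) (h1 : u < 1) : 0 ≤ (reDilog u + Real.log u * Real.log (1 - u)) / u :=
  (hasSum_Ek_div h0 h1).nonneg (Ek_term_nonneg h0 h1)

/-- `E(u) ≥ 0` on `(0,1)`. [folklore] -/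
theorem Ek_nonneg {u : ℝ} (h0 : 0 < u) (h1 : u < 1) : 0 ≤ (reDilog u + Real.log u * Real.log (1 - u)) := by
  have h := Ek_div_nonneg h0 h1
  rwa [div_nonneg_iff, or_iff_left (by intro h'; linarith [h'.2]), and_iff_left h0.le] at h

/-- The series of `E(u)/u` in `ℝ≥0∞`: `ofReal (E(u)/u) = Σ' ofReal (uⁿ (1/(n+1)² + ℓ/(n+1)))` on `(0,1)`. [folklore] -/
theorem ofReal_Ek_div {u : ℝ} (h0 : 0 < u) (h1 : u < 1) :
    ENNReal.ofReal ((reDilog u + Real.log u * Real.log (1 - u)) / u) =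
      ∑' n : ℕ, ENNReal.ofReal (u ^ n * (1 / ((n : ℝ) + 1) ^ 2 + (-Real.log u) / ((n : ℝ) + 1))) := by
  rw [← (hasSum_Ek_div h0 h1).tsum_eq, ENNReal.ofReal_tsum_of_nonneg (Ek_term_nonneg h0 h1)
    (hasSum_Ek_div h0 h1).summable]

/-- The Euler kernel is measurable. [folklore] -/
theorem measurable_Ek : Measurable (fun u : ℝ => (reDilog u + Real.log u * Real.log (1 - u))) := by
  have h : Continuous reDilog := continuous_reDilog
  fun_prop

/-! ## 2. The one-variable moments `∫₀¹ uⁿ ℓᵖ du = p!/(n+1)^{p+1}` in `ℝ≥0∞` -/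

/-- `∫⁻_{(0,1)} c · uⁿ (−log u)ᵖ du = c · p!/(n+1)^{p+1}` for `c ≥ 0` (Gradshteyn–Ryzhik 4.272 6, from the tree's
`integral_rpow_mul_log_pow_zero_one`). [folklore] -/
theorem lintegral_const_mul_pow_mul_negLog_pow (c : ℝ) (hc : 0 ≤ c) (n p : ℕ) :
    ∫⁻ u in Ioo (0:ℝ) 1, ENNReal.ofReal (c * (u ^ n * (-Real.log u) ^ p)) =
      ENNReal.ofReal (c * ((p ! : ℝ) / ((n : ℝ) + 1) ^ (p + 1))) := by
  have hs : (-1 : ℝ) < (n : ℝ) := by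
    have : (0 : ℝ) ≤ n := Nat.cast_nonneg n
    linarith
  -- the real-valued integral over `(0,1)`
  have hint : IntervalIntegrable (fun u : ℝ => u ^ (n : ℝ) * Real.log u ^ p) volume 0 1 :=
    Literature.Analysis.SpecialFunctions.intervalIntegrable_rpow_mul_log_pow hs p zero_le_one
  have hval : ∫ u in (0:ℝ)..1, u ^ (n : ℝ) * Real.log u ^ p = (-1) ^ p * (p ! : ℝ) / ((n : ℝ) + 1) ^ (p + 1) :=
    Literature.Analysis.SpecialFunctions.integral_rpow_mul_log_pow_zero_one hs p
  -- rewrite the integrand on `(0,1)`: `c · uⁿ (−log u)ᵖ = c (−1)ᵖ · (u^{(n:ℝ)} log^p u)`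
  have hfun : ∀ u ∈ Ioo (0:ℝ) 1, c * (u ^ n * (-Real.log u) ^ p) = c * (-1) ^ p * (u ^ (n : ℝ) * Real.log u ^ p) := by
    intro u hu
    rw [Real.rpow_natCast, neg_pow]
    ring
  have hnn : ∀ u ∈ Ioo (0:ℝ) 1, 0 ≤ c * (u ^ n * (-Real.log u) ^ p) := by
    intro u hu
    have hl : 0 ≤ -Real.log u := by rw [neg_nonneg]; exact Real.log_nonpos hu.1.le hu.2.le
    have := hu.1.le
    positivity
  have hInt : IntegrableOn (fun u : ℝ => c * (-1) ^ p * (u ^ (n : ℝ) * Real.log u ^ p)) (Ioo 0 1) := by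
    have h2 := (hint.const_mul (c * (-1) ^ p))
    rw [intervalIntegrable_iff_integrableOn_Ioo_of_le zero_le_one] at h2
    exact h2
  rw [setLIntegral_congr_fun measurableSet_Ioo (fun u hu => by rw [hfun u hu]),
    ← ofReal_integral_eq_lintegral_ofReal hInt]
  · congr 1
    rw [MeasureTheory.integral_const_mul, ← integral_Ioc_eq_integral_Ioo, ← intervalIntegral.integral_of_le zero_le_one, hval]
    rw [show c * (-1 : ℝ) ^ p * ((-1) ^ p * (p ! : ℝ) / ((n : ℝ) + 1) ^ (p + 1)) =
      c * ((-1 : ℝ) ^ p * (-1) ^ p) * (p ! : ℝ) / ((n : ℝ) + 1) ^ (p + 1) by ring,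
      ← mul_pow, neg_one_mul, neg_neg, one_pow, mul_one, mul_div_assoc]
  · refine (ae_restrict_mem measurableSet_Ioo).mono fun u hu => ?_
    simp only [Pi.zero_apply]
    rw [← hfun u hu]
    exact hnn u hu

/-! ## 3. The engine: `∫₀¹ uʲ ℓᵖ E(u) du/u = Σ_{n ≥ 0} [p!/((n+1)²(n+j+1)^{p+1}) + (p+1)!/((n+1)(n+j+1)^{p+2})]` -/

/-- The basis integrand `uʲ (−log u)ᵖ E(u)/u` is measurable. [folklore] -/
theorem measurable_basis (j p : ℕ) :
    Measurable (fun u : ℝ => u ^ j * (-Real.log u) ^ p * ((reDilog u + Real.log u * Real.log (1 - u)) / u)) := by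
  have h : Continuous reDilog := continuous_reDilog
  fun_prop

/-- The basis integrand is non-negative on `(0,1)`. [folklore] -/
theorem basis_nonneg (j p : ℕ) {u : ℝ} (h0 : 0 < u) (h1 : u < 1) :
    0 ≤ u ^ j * (-Real.log u) ^ p * ((reDilog u + Real.log u * Real.log (1 - u)) / u) := by
  have hl : 0 ≤ -Real.log u := by rw [neg_nonneg]; exact Real.log_nonpos h0.le h1.le
  have hE := Ek_div_nonneg h0 h1
  positivity

/-- Termwise expansion of the basis integrand in `ℝ≥0∞` on `(0,1)`:
`ofReal (uʲ ℓᵖ E(u)/u) = Σ' [ofReal ((n+1)^{−2} · u^{n+j} ℓᵖ) + ofReal ((n+1)^{−1} · u^{n+j} ℓ^{p+1})]`. [folklore] -/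
theorem ofReal_basis_eq_tsum (j p : ℕ) {u : ℝ} (h0 : 0 < u) (h1 : u < 1) :
    ENNReal.ofReal (u ^ j * (-Real.log u) ^ p * ((reDilog u + Real.log u * Real.log (1 - u)) / u)) =
      ∑' n : ℕ, (ENNReal.ofReal (1 / ((n : ℝ) + 1) ^ 2 * (u ^ (n + j) * (-Real.log u) ^ p)) +
        ENNReal.ofReal (1 / ((n : ℝ) + 1) * (u ^ (n + j) * (-Real.log u) ^ (p + 1)))) := by
  have hl : 0 ≤ -Real.log u := by rw [neg_nonneg]; exact Real.log_nonpos h0.le h1.le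
  have hw : 0 ≤ u ^ j * (-Real.log u) ^ p := by positivity
  rw [ENNReal.ofReal_mul hw, ofReal_Ek_div h0 h1, ← ENNReal.tsum_mul_left]
  refine tsum_congr fun n => ?_
  rw [← ENNReal.ofReal_mul hw, ← ENNReal.ofReal_add (by positivity) (by positivity)]
  congr 1
  rw [pow_add, pow_succ]
  ring

/-- **The engine** (`ℝ≥0∞` form): for all `j, p ∈ ℕ`,
`∫⁻_{(0,1)} uʲ (−log u)ᵖ E(u)/u du = Σ'_{n ≥ 0} ofReal (p!/((n+1)²(n+j+1)^{p+1}) + (p+1)!/((n+1)(n+j+1)^{p+2}))`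
— termwise integration of the non-negative series of `E(u)/u` (Tonelli for series, `lintegral_tsum`) and the moments
`∫₀¹ uᵐ ℓ^q = q!/(m+1)^{q+1}`. [folklore] -/
theorem lintegral_basis (j p : ℕ) :
    ∫⁻ u in Ioo (0:ℝ) 1, ENNReal.ofReal (u ^ j * (-Real.log u) ^ p * ((reDilog u + Real.log u * Real.log (1 - u)) / u)) =
      ∑' n : ℕ, ENNReal.ofReal (1 / ((n : ℝ) + 1) ^ 2 * ((p ! : ℝ) / ((n : ℝ) + j + 1) ^ (p + 1)) +
        1 / ((n : ℝ) + 1) * (((p + 1) ! : ℝ) / ((n : ℝ) + j + 1) ^ (p + 2))) := by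
  rw [setLIntegral_congr_fun measurableSet_Ioo (fun u hu => ofReal_basis_eq_tsum j p hu.1 hu.2)]
  rw [lintegral_tsum (fun n => by
    apply Measurable.aemeasurable
    fun_prop)]
  refine tsum_congr fun n => ?_
  rw [lintegral_add_left (by fun_prop),
    lintegral_const_mul_pow_mul_negLog_pow _ (by positivity) (n + j) p,
    lintegral_const_mul_pow_mul_negLog_pow _ (by positivity) (n + j) (p + 1),
    ← ENNReal.ofReal_add (by positivity) (by positivity)]
  push_cast
  ring_nf

/-- **The engine** (real form): if the series `Σ [p!/((n+1)²(n+j+1)^{p+1}) + (p+1)!/((n+1)(n+j+1)^{p+2})]` has sum `S`,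
then `uʲ (−log u)ᵖ E(u)/u` is integrable on `(0,1)` with integral `S`. [folklore] -/
theorem integral_basis (j p : ℕ) {S : ℝ}
    (hS : HasSum (fun n : ℕ => 1 / ((n : ℝ) + 1) ^ 2 * ((p ! : ℝ) / ((n : ℝ) + j + 1) ^ (p + 1)) +
        1 / ((n : ℝ) + 1) * (((p + 1) ! : ℝ) / ((n : ℝ) + j + 1) ^ (p + 2))) S) :
    IntegrableOn (fun u : ℝ => u ^ j * (-Real.log u) ^ p * ((reDilog u + Real.log u * Real.log (1 - u)) / u)) (Ioo 0 1) ∧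
      ∫ u in Ioo (0:ℝ) 1, u ^ j * (-Real.log u) ^ p * ((reDilog u + Real.log u * Real.log (1 - u)) / u) = S := by
  have hterm : ∀ n : ℕ, 0 ≤ 1 / ((n : ℝ) + 1) ^ 2 * ((p ! : ℝ) / ((n : ℝ) + j + 1) ^ (p + 1)) +
      1 / ((n : ℝ) + 1) * (((p + 1) ! : ℝ) / ((n : ℝ) + j + 1) ^ (p + 2)) := fun n => by positivity
  have hS0 : 0 ≤ S := hS.nonneg hterm
  have hL : ∫⁻ u in Ioo (0:ℝ) 1, ENNReal.ofReal (u ^ j * (-Real.log u) ^ p * ((reDilog u + Real.log u * Real.log (1 - u)) / u)) = ENNReal.ofReal S := by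
    rw [lintegral_basis, ← ENNReal.ofReal_tsum_of_nonneg hterm hS.summable, hS.tsum_eq]
  have hnn : 0 ≤ᵐ[volume.restrict (Ioo (0:ℝ) 1)] (fun u : ℝ => u ^ j * (-Real.log u) ^ p * ((reDilog u + Real.log u * Real.log (1 - u)) / u)) :=
    (ae_restrict_mem measurableSet_Ioo).mono fun u hu => basis_nonneg j p hu.1 hu.2
  have hmeas := (measurable_basis j p).aestronglyMeasurable (μ := volume.restrict (Ioo (0:ℝ) 1))
  refine ⟨⟨hmeas, ?_⟩, ?_⟩
  · rw [hasFiniteIntegral_iff_ofReal hnn, hL]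
    exact ENNReal.ofReal_lt_top
  · rw [integral_eq_lintegral_of_nonneg_ae hnn hmeas, hL, ENNReal.toReal_ofReal hS0]

/-- The engine, transported to any integrand that agrees with `uʲ (−log u)ᵖ E(u)/u` on `(0,1)`. [folklore] -/
theorem basis_of_eqOn (j p : ℕ) {S : ℝ}
    (hS : HasSum (fun n : ℕ => 1 / ((n : ℝ) + 1) ^ 2 * ((p ! : ℝ) / ((n : ℝ) + j + 1) ^ (p + 1)) +
        1 / ((n : ℝ) + 1) * (((p + 1) ! : ℝ) / ((n : ℝ) + j + 1) ^ (p + 2))) S)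
    {g : ℝ → ℝ} (hg : ∀ u ∈ Ioo (0:ℝ) 1, g u = u ^ j * (-Real.log u) ^ p * ((reDilog u + Real.log u * Real.log (1 - u)) / u)) :
    IntegrableOn g (Ioo 0 1) ∧ ∫ u in Ioo (0:ℝ) 1, g u = S := by
  obtain ⟨hI, hv⟩ := integral_basis j p hS
  refine ⟨hI.congr_fun (fun u hu => (hg u hu).symm) measurableSet_Ioo, ?_⟩
  rw [setIntegral_congr_fun measurableSet_Ioo hg, hv]

/-! ## 4. The nine `E`-linear basis integrals (gen-1 g17 `LEVEL1-EXACT.md` Thm E: `B1–B5, B4', B9–B11`) -/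

/-- **B3.** `∫₀¹ E(u) du/u = 2ζ(3)` (with integrability on `(0,1)`). [folklore] -/
theorem integral_Ek_div :
    IntegrableOn (fun u : ℝ => (reDilog u + Real.log u * Real.log (1 - u)) / u) (Ioo 0 1) ∧ ∫ u in Ioo (0:ℝ) 1, (reDilog u + Real.log u * Real.log (1 - u)) / u = 2 * zetaValue 3 := by
  refine basis_of_eqOn 0 0 ?_ (fun u hu => by simp)
  exact ((hasSum_inv_succ_pow (k := 3) (by norm_num)).mul_left 2).congr_fun fun n => by
    simp only [Nat.factorial, Nat.cast_zero, Nat.cast_succ]; field_simp; ring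

/-- **B5.** `∫₀¹ (−log u) E(u) du/u = 3ζ(4)`. [folklore] -/
theorem integral_negLog_mul_Ek_div :
    IntegrableOn (fun u : ℝ => (-Real.log u) * (reDilog u + Real.log u * Real.log (1 - u)) / u) (Ioo 0 1) ∧
      ∫ u in Ioo (0:ℝ) 1, (-Real.log u) * (reDilog u + Real.log u * Real.log (1 - u)) / u = 3 * zetaValue 4 := by
  refine basis_of_eqOn 0 1 ?_ (fun u hu => by simp; ring)
  exact ((hasSum_inv_succ_pow (k := 4) (by norm_num)).mul_left 3).congr_fun fun n => by
    simp only [Nat.factorial, Nat.cast_zero, Nat.cast_succ]; field_simp; ring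

/-- **B10.** `∫₀¹ (−log u)² E(u) du/u = 8ζ(5)`. [folklore] -/
theorem integral_negLog_sq_mul_Ek_div :
    IntegrableOn (fun u : ℝ => (-Real.log u) ^ 2 * (reDilog u + Real.log u * Real.log (1 - u)) / u) (Ioo 0 1) ∧
      ∫ u in Ioo (0:ℝ) 1, (-Real.log u) ^ 2 * (reDilog u + Real.log u * Real.log (1 - u)) / u = 8 * zetaValue 5 := by
  refine basis_of_eqOn 0 2 ?_ (fun u hu => by simp; ring)
  exact ((hasSum_inv_succ_pow (k := 5) (by norm_num)).mul_left 8).congr_fun fun n => by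
    simp only [Nat.factorial, Nat.cast_zero, Nat.cast_succ]; field_simp; ring

/-- **B1.** `∫₀¹ E(u) du = 1` (`Σ [1/(n²(n+1)) + 1/(n(n+1)²)] = Σ [1/n² − 1/(n+1)²]`). [folklore] -/
theorem integral_Ek :
    IntegrableOn (fun u : ℝ => (reDilog u + Real.log u * Real.log (1 - u))) (Ioo 0 1) ∧ ∫ u in Ioo (0:ℝ) 1, (reDilog u + Real.log u * Real.log (1 - u)) = 1 := by
  refine basis_of_eqOn 1 0 ?_ (fun u hu => by have := hu.1.ne'; field_simp)
  have h := (hasSum_inv_succ_pow (k := 2) le_rfl).sub (hasSum_inv_add_two_pow (k := 2) le_rfl)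
  rw [show zetaValue 2 - (zetaValue 2 - 1) = 1 by ring] at h
  exact h.congr_fun fun n => by
    simp only [Nat.factorial, Nat.cast_zero, Nat.cast_succ]; field_simp; ring

/-- **B4.** `∫₀¹ (−log u) E(u) du = 3 − 2ζ(3)` (`1/(n²(n+1)²) + 2/(n(n+1)³) = 1/n² − 1/(n+1)² − 2/(n+1)³`). [folklore] -/
theorem integral_negLog_mul_Ek :
    IntegrableOn (fun u : ℝ => (-Real.log u) * (reDilog u + Real.log u * Real.log (1 - u))) (Ioo 0 1) ∧
      ∫ u in Ioo (0:ℝ) 1, (-Real.log u) * (reDilog u + Real.log u * Real.log (1 - u)) = 3 - 2 * zetaValue 3 := by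
  refine basis_of_eqOn 1 1 ?_ (fun u hu => by have := hu.1.ne'; field_simp)
  have h := ((hasSum_inv_succ_pow (k := 2) le_rfl).sub (hasSum_inv_add_two_pow (k := 2) le_rfl)).sub
    ((hasSum_inv_add_two_pow (k := 3) (by norm_num)).mul_left 2)
  rw [show zetaValue 2 - (zetaValue 2 - 1) - 2 * (zetaValue 3 - 1) = 3 - 2 * zetaValue 3 by ring] at h
  exact h.congr_fun fun n => by
    simp only [Nat.factorial, Nat.cast_zero, Nat.cast_succ]; field_simp; ring

/-- **B9.** `∫₀¹ (−log u)² E(u) du = 12 − 4ζ(3) − 6ζ(4)`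
(`2/(n²(n+1)³) + 6/(n(n+1)⁴) = 2/n² − 2/(n+1)² − 4/(n+1)³ − 6/(n+1)⁴`). [folklore] -/
theorem integral_negLog_sq_mul_Ek :
    IntegrableOn (fun u : ℝ => (-Real.log u) ^ 2 * (reDilog u + Real.log u * Real.log (1 - u))) (Ioo 0 1) ∧
      ∫ u in Ioo (0:ℝ) 1, (-Real.log u) ^ 2 * (reDilog u + Real.log u * Real.log (1 - u)) = 12 - 4 * zetaValue 3 - 6 * zetaValue 4 := by
  refine basis_of_eqOn 1 2 ?_ (fun u hu => by have := hu.1.ne'; field_simp)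
  have h := ((((hasSum_inv_succ_pow (k := 2) le_rfl).sub (hasSum_inv_add_two_pow (k := 2) le_rfl)).mul_left 2).sub
    ((hasSum_inv_add_two_pow (k := 3) (by norm_num)).mul_left 4)).sub
    ((hasSum_inv_add_two_pow (k := 4) (by norm_num)).mul_left 6)
  rw [show 2 * (zetaValue 2 - (zetaValue 2 - 1)) - 4 * (zetaValue 3 - 1) - 6 * (zetaValue 4 - 1) =
    12 - 4 * zetaValue 3 - 6 * zetaValue 4 by ring] at h
  exact h.congr_fun fun n => by
    simp only [Nat.factorial, Nat.cast_zero, Nat.cast_succ]; field_simp; ring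

/-- **B2.** `∫₀¹ u E(u) du = 5/8` (`1/(n²(n+2)) + 1/(n(n+2)²) = (1/2)(1/n² − 1/(n+2)²)`). [folklore] -/
theorem integral_mul_Ek :
    IntegrableOn (fun u : ℝ => u * (reDilog u + Real.log u * Real.log (1 - u))) (Ioo 0 1) ∧ ∫ u in Ioo (0:ℝ) 1, u * (reDilog u + Real.log u * Real.log (1 - u)) = 5 / 8 := by
  refine basis_of_eqOn 2 0 ?_ (fun u hu => by have := hu.1.ne'; field_simp)
  have h := ((hasSum_inv_succ_pow (k := 2) le_rfl).sub (hasSum_inv_add_three_pow (k := 2) le_rfl)).mul_left (1/2)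
  rw [show (1:ℝ) / 2 * (zetaValue 2 - (zetaValue 2 - 1 - 1 / 2 ^ 2)) = 5 / 8 by ring] at h
  exact h.congr_fun fun n => by
    simp only [Nat.factorial, Nat.cast_zero, Nat.cast_succ]; field_simp; ring

/-- **B4'.** `∫₀¹ u (−log u) E(u) du = 23/16 − ζ(3)`
(`1/(n²(n+2)²) + 2/(n(n+2)³) = (1/4)/n² − (1/4)/(n+2)² − 1/(n+2)³`). [folklore] -/
theorem integral_mul_negLog_mul_Ek :
    IntegrableOn (fun u : ℝ => u * (-Real.log u) * (reDilog u + Real.log u * Real.log (1 - u))) (Ioo 0 1) ∧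
      ∫ u in Ioo (0:ℝ) 1, u * (-Real.log u) * (reDilog u + Real.log u * Real.log (1 - u)) = 23 / 16 - zetaValue 3 := by
  refine basis_of_eqOn 2 1 ?_ (fun u hu => by have := hu.1.ne'; field_simp)
  have h := (((hasSum_inv_succ_pow (k := 2) le_rfl).sub (hasSum_inv_add_three_pow (k := 2) le_rfl)).mul_left
    (1/4)).sub (hasSum_inv_add_three_pow (k := 3) (by norm_num))
  rw [show (1:ℝ) / 4 * (zetaValue 2 - (zetaValue 2 - 1 - 1 / 2 ^ 2)) - (zetaValue 3 - 1 - 1 / 2 ^ 3) =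
    23 / 16 - zetaValue 3 by ring] at h
  exact h.congr_fun fun n => by
    simp only [Nat.factorial, Nat.cast_zero, Nat.cast_succ]; field_simp; ring

/-- **B11.** `∫₀¹ u (−log u)² E(u) du = 37/8 − ζ(3) − 3ζ(4)`
(`2/(n²(n+2)³) + 6/(n(n+2)⁴) = (1/4)/n² − (1/4)/(n+2)² − 1/(n+2)³ − 3/(n+2)⁴`). [folklore] -/
theorem integral_mul_negLog_sq_mul_Ek :
    IntegrableOn (fun u : ℝ => u * (-Real.log u) ^ 2 * (reDilog u + Real.log u * Real.log (1 - u))) (Ioo 0 1) ∧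
      ∫ u in Ioo (0:ℝ) 1, u * (-Real.log u) ^ 2 * (reDilog u + Real.log u * Real.log (1 - u)) = 37 / 8 - zetaValue 3 - 3 * zetaValue 4 := by
  refine basis_of_eqOn 2 2 ?_ (fun u hu => by have := hu.1.ne'; field_simp)
  have h := ((((hasSum_inv_succ_pow (k := 2) le_rfl).sub (hasSum_inv_add_three_pow (k := 2) le_rfl)).mul_left
    (1/4)).sub (hasSum_inv_add_three_pow (k := 3) (by norm_num))).sub
    ((hasSum_inv_add_three_pow (k := 4) (by norm_num)).mul_left 3)
  rw [show (1:ℝ) / 4 * (zetaValue 2 - (zetaValue 2 - 1 - 1 / 2 ^ 2)) - (zetaValue 3 - 1 - 1 / 2 ^ 3)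
    - 3 * (zetaValue 4 - 1 - 1 / 2 ^ 4) = 37 / 8 - zetaValue 3 - 3 * zetaValue 4 by ring] at h
  exact h.congr_fun fun n => by
    simp only [Nat.factorial, Nat.cast_zero, Nat.cast_succ]; field_simp; ring

end Summit.KontsevichZagierPeriods.Zeta5Search.EulerKernel
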